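import Mathlib
import Literature.AlgebraicGeometry.Resolution.ResolutionLU
import Literature.AlgebraicGeometry.Resolution.ResolutionOfComponents
import Literature.AlgebraicGeometry.Resolution.JacobianRegularLocus
import HarnessLib

/-!
# Crux `LogCanQuotLU` (stmt-ResolutionOfSingularities-17082), line `birth`:
# stub `stub_resolutionToConstantsModel` — a resolution of the constants model uniformizes the
# field of constants along `O`

Route `ResolutionOfSingularities/FoliationDescent`, crux #3 `LogCanQuotLU` (local uniformization
of the field of constants `K^D` of a `k`-derivation `D` of `K` along a valuation ring `O` of `K`).
This file proves the transport stub `stub_resolutionToConstantsModel` of the line `birth`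
(`Cruxes/LogCanQuotLU/Lines/birth.lean`, `Sig.stub_resolutionToConstantsModel`, verbatim):

> let `C ⊆ O` be a finitely generated `k`-subalgebra of `D`-constants whose fractions exhaust
> the field of constants `K^D = ker D`, and assume `Spec C` admits a resolution of singularities.
> Then there is a finitely generated `k`-subalgebra `C ≤ A ≤ O` of `D`-constants whose local ring
> at the centre `𝔪_O ∩ A` of `O` is regular.

## Proof ("resolution ⇒ local uniformization", transported to the field of constants)

* `L := K^D = {x | D x = 0}` is an intermediate field of `K / k` (Leibniz rule, `D (x⁻¹)`,
  `D ∘ algebraMap = 0`); write `f : L → K` for the inclusion.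
* Restrict: `O_L := O ∩ L` (`ValuationSubring.comap`) is a valuation ring of `L`, and
  `C_L := C ∩ L` (`Subalgebra.comap`) satisfies `C_L.map f = C` (as `C ⊆ L`), so `C_L` is
  finitely generated, `C_L ⊆ O_L`, and `Frac C_L = L` by the hypothesis on fractions.
* `C_L ≅ C` as rings, so `Spec C ≅ Spec C_L` and the resolution of `Spec C` transports
  (`Scheme.HasResolution.of_iso`).
* The tree's `exists_affineModel_regular_of_hasResolution` (valuative criterion of properness +
  an affine chart at the centre, `Literature/AlgebraicGeometry/Resolution/ResolutionLU.lean`)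
  gives a finitely generated `C_L ≤ A_L ≤ O_L` regular at the centre of `O_L`.
* `A := A_L.map f ⊆ O` is finitely generated, consists of constants, contains `C`, and its local
  ring at the centre of `O` is that of `A_L` at the centre of `O_L`, transported along the ring
  isomorphism `A_L ≅ A` (`mem_regularLocus_iff_of_ringEquiv`; the centre restricts:
  `a ∈ 𝔪_{O ∩ L} ↔ a ∈ 𝔪_O`) — exactly the bookkeeping of `Cruxes/LogCanQuotLU/Disproof.lean`,
  `logCanQuotLU_body_of_relLU`.

No hypothesis on the characteristic, on `D` or on `k` is needed. Nothing here mentions the route;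
no definition is declared (the field of constants is built inline).

Main result: `stub_resolutionToConstantsModel` (registered signature of the line, verbatim).
-/

set_option linter.dupNamespace false -- single-problem summit: doubled namespace component is forced

noncomputable section

open IsLocalRing CategoryTheory AlgebraicGeometry
open Literature.AlgebraicGeometry.Resolution

namespace Summit.ResolutionOfSingularities.ResolutionOfSingularities.Theorems

/-- **Resolution of the constants model ⇒ local uniformization of `K^D` along `O` above `C`.**
For a valuation ring `O` of `K ⊇ k`, a `k`-derivation `D` of `K` and a finitely generated
`k`-subalgebra `C ⊆ O` of `D`-constants with `Frac C = K^D`: if `Spec C` has a resolution of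
singularities, then some finitely generated `k`-subalgebra `C ≤ A ≤ O` of `D`-constants is
regular at the centre of `O` (transport to the field of constants,
`exists_affineModel_regular_of_hasResolution`, transport back). This is
`Sig.stub_resolutionToConstantsModel` of `Cruxes/LogCanQuotLU/Lines/birth.lean`, verbatim.
[folklore] -/
theorem stub_resolutionToConstantsModel :
  ∀ (k K : Type) [Field k] [Field K] [Algebra k K] (O : ValuationSubring K)
    (D : Derivation k K K) (C : Subalgebra k K),
    C.toSubring ≤ O.toSubring → C.FG → (∀ x ∈ C, D x = 0) →
    (∀ x : K, D x = 0 → ∃ a b : K, a ∈ C ∧ b ∈ C ∧ b ≠ 0 ∧ x = a / b) →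
    Literature.AlgebraicGeometry.Resolution.Scheme.HasResolution
      (AlgebraicGeometry.Spec (CommRingCat.of C)) →
    ∃ (A : Subalgebra k K) (hA : A.toSubring ≤ O.toSubring), C ≤ A ∧ A.FG ∧ (∀ x ∈ A, D x = 0) ∧
      IsRegularLocalRing
        (Localization.AtPrime
          (Ideal.comap (Subring.inclusion hA) (IsLocalRing.maximalIdeal O))) := by
  intro k K _ _ _ O D C hCO hCfg hCconst hCfrac hres
  classical
  -- (1) the field of constants `L = K^D`, an intermediate field of `K / k`
  let L : IntermediateField k K :=
    { carrier := {x | D x = 0}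
      mul_mem' := fun {a b} ha hb => by
        simp only [Set.mem_setOf_eq] at ha hb ⊢
        rw [Derivation.leibniz, ha, hb, smul_zero, smul_zero, add_zero]
      one_mem' := by simp
      add_mem' := fun {a b} ha hb => by
        simp only [Set.mem_setOf_eq] at ha hb ⊢
        rw [map_add, ha, hb, add_zero]
      zero_mem' := by simp
      algebraMap_mem' := fun c => by simp
      inv_mem' := fun x hx => by
        simp only [Set.mem_setOf_eq] at hx ⊢
        rw [Derivation.leibniz_inv, hx, smul_zero] }
  have hmemL : ∀ x : K, x ∈ L ↔ D x = 0 := fun x => Iff.rfl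
  -- (2) restriction of `O` and `C` to `L`
  set f : L →+* K := algebraMap L K with hf
  have hfinj : Function.Injective f := (algebraMap L K).injective
  have hvalinj : Function.Injective L.val := hfinj
  set OL : ValuationSubring L := O.comap f with hOL
  set CL : Subalgebra k L := C.comap L.val with hCL
  have hCrange : C ≤ L.val.range := fun x hx => ⟨⟨x, (hmemL x).mpr (hCconst x hx)⟩, rfl⟩
  have hCLmap : CL.map L.val = C := by
    rw [hCL, Subalgebra.map_comap_eq]
    exact inf_eq_left.mpr hCrange
  have hCLfg : CL.FG :=
    Subalgebra.fg_of_fg_map _ L.val hvalinj (by rw [hCLmap]; exact hCfg)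
  have hCLO : CL.toSubring ≤ OL.toSubring := fun x hx => hCO (show L.val x ∈ C from hx)
  have hCLfr : IsFractionRing CL L := by
    refine IsFractionRing.of_field CL L fun z => ?_
    obtain ⟨a, b, ha, hb, -, hz⟩ := hCfrac (z : K) z.2
    have haL : a ∈ L := (hmemL a).mpr (hCconst a ha)
    have hbL : b ∈ L := (hmemL b).mpr (hCconst b hb)
    refine ⟨⟨⟨a, haL⟩, show L.val ⟨a, haL⟩ ∈ C from ha⟩,
      ⟨⟨b, hbL⟩, show L.val ⟨b, hbL⟩ ∈ C from hb⟩, hfinj ?_⟩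
    rw [map_div₀]
    exact hz
  -- (3) `Spec C_L` has a resolution: `C_L ≅ C` as `k`-algebras, so `Spec C ≅ Spec C_L`
  let eC : CL ≃ₐ[k] C :=
    (CL.equivMapOfInjective L.val hvalinj).trans (Subalgebra.equivOfEq _ _ hCLmap)
  have hresL : Scheme.HasResolution (Spec (.of CL)) :=
    Scheme.HasResolution.of_iso (Scheme.Spec.mapIso eC.toRingEquiv.toCommRingCatIso.op).hom hres
  -- (4) relative local uniformization of `O_L` above `C_L`, from the resolution
  obtain ⟨AL, hAL, hCLAL, hALfg, hALreg⟩ :=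
    exists_affineModel_regular_of_hasResolution OL CL hCLO hCLfg hCLfr hresL
  -- (5) transport to `K`
  set A : Subalgebra k K := AL.map L.val with hA
  have hmem : ∀ z : K, z ∈ A ↔ ∃ a ∈ AL, f a = z := fun z => Subalgebra.mem_map
  have hAO : A.toSubring ≤ O.toSubring := by
    intro z hz
    obtain ⟨a, ha, rfl⟩ := (hmem z).mp hz
    exact hAL ha
  refine ⟨A, hAO, ?_, hALfg.map _, ?_, ?_⟩
  · -- `C ≤ A`
    intro x hx
    rw [← hCLmap] at hx
    obtain ⟨y, hy, rfl⟩ := Subalgebra.mem_map.mp hx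
    exact Subalgebra.mem_map.mpr ⟨y, hCLAL hy, rfl⟩
  · -- `A` consists of constants
    intro x hx
    obtain ⟨a, -, rfl⟩ := (hmem x).mp hx
    exact a.2
  · -- regularity at the centre: transport along `A_L ≅ A_L.map f`
    set S : Subring K := AL.toSubring.map f with hS_def
    have hS : S ≤ O.toSubring := by
      rintro z ⟨a, ha, rfl⟩
      exact hAL ha
    have e' : A.toSubring = S := by
      ext z
      rw [Subalgebra.mem_toSubring, hmem, Subring.mem_map]
      constructor
      · rintro ⟨a, ha, rfl⟩
        exact ⟨a, ha, rfl⟩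
      · rintro ⟨a, ha, rfl⟩
        exact ⟨a, ha, rfl⟩
    refine isRegularLocalRing_centre_of_toSubring_eq O A hAO hS e' ?_
    let e : AL.toSubring ≃+* S := AL.toSubring.equivMapOfInjective f hfinj
    set P : Ideal S := Ideal.comap (Subring.inclusion hS) (maximalIdeal O) with hP
    haveI hPp : P.IsPrime := Ideal.comap_isPrime _ _
    -- `S_P` is regular iff `(A_L)_{e⁻¹ P}` is (`mem_regularLocus_iff_of_ringEquiv`)
    refine (show IsRegularLocalRing (Localization.AtPrime P) ↔
        IsRegularLocalRing (Localization.AtPrime (P.comap (e : AL.toSubring →+* S))) from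
      mem_regularLocus_iff_of_ringEquiv e ⟨P, hPp⟩).mpr ?_
    -- the centre restricts: `a ∈ 𝔪_{O ∩ L} ↔ f a ∈ 𝔪_O`
    have hcentre : ∀ {a : L} (ha : a ∈ O.comap f),
        (⟨a, ha⟩ : O.comap f) ∈ maximalIdeal (O.comap f) ↔
          (⟨f a, ha⟩ : O) ∈ maximalIdeal O := by
      intro a ha
      rw [← ValuationSubring.coe_mem_nonunits_iff, ← ValuationSubring.coe_mem_nonunits_iff,
        ValuationSubring.mem_nonunits_iff_or, ValuationSubring.mem_nonunits_iff_or]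
      show a = 0 ∨ a⁻¹ ∉ O.comap f ↔ f a = 0 ∨ (f a)⁻¹ ∉ O
      rw [map_eq_zero f, ValuationSubring.mem_comap, map_inv₀]
    have hPe : P.comap (e : AL.toSubring →+* S) =
        Ideal.comap (Subring.inclusion hAL) (maximalIdeal (O.comap f)) := by
      ext a
      have h2 : Subring.inclusion hS (e a) = ⟨f a, hAL a.2⟩ :=
        Subtype.ext (Subring.coe_equivMapOfInjective_apply _ f hfinj a)
      have h3 : Subring.inclusion hAL a = ⟨(a : L), hAL a.2⟩ := rfl
      simp only [Ideal.mem_comap, hP, RingHom.coe_coe]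
      rw [h2, h3]
      exact (hcentre (hAL a.2)).symm
    haveI : (P.comap (e : AL.toSubring →+* S)).IsPrime := Ideal.comap_isPrime _ _
    exact isRegularLocalRing_localization_atPrime_congr hPe.symm hALreg

end Summit.ResolutionOfSingularities.ResolutionOfSingularities.Theorems

end
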